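import Summits.QuantumFields.BalabanUV.Beta.D1BFx.AveragingJetNeedle
import Summits.QuantumFields.BalabanUV.Beta.D1BFx.GhostStencilRooted

/-!
# `BalabanUV.Beta.D1BFx.GhostNeedleRootedLetters` — road «BF-x» for binder row D1, slot (K), END row `hGrp gN` (NEEDLES ∪ G_R), (N-1) letters
# M1–M3 of an3-g56's NEEDLE-PROFILES memo FOR THE ROOTED GHOST NEEDLE OF RECORD `qA = qAntiAt (ctrHalf n) n`: the SHARP size `(n⁴)⁻¹` of the
# root-parametric averaging jet `qJetAt ρ n`, its endpoint- and root-side NEEDLE SUPPORT, its block-`ℓ¹` mass `n^{κ′+1}·(n⁴)⁻¹`, the sharp entry bound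
# `2·(n⁴)⁻¹` and localisation socket of `qAntiAt ρ n`, and the count × sup block double sum — for EVERY root `ρ` (no in-block hypothesis needed)

HONEST DEPENDENCY (cell records, verbatim): «continuum YM on T⁴ ⇐ BetaPertH ∧ nine spine estimates (0/9 proved); BetaPertH ⇐ (D1) ∧ (D4) ∧
CAP+tail; G-an2-4 gates asym, D1 and NE2/3/4.»  HONEST FRAMING (cell contract, verbatim): «discharging `BetaPertH` makes Bałaban's UV stability
UNCONDITIONAL — a real constructive-QFT result; it is NOT the continuum limit and NOT the Clay problem.»  THIS MODULE DISCHARGES NOTHING of the wall: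
it is [folklore] finite bookkeeping — the proofs of `AveragingJetNeedle.abs_qJet_le_inv_pow_four` ∕ `qJet_eq_zero_of_upper_ne` ∕ `qJet_le_indicator` ∕
`sum_B_abs_qJet_le` (root `n•y`, leaf-09∕an3 lineage) VERBATIM at the root `n•y + ρ`, over the ROOT-GENERIC contour letters `AveragingJetNeedle.abs_gammaCoeff_le_one`,
`gammaCoeff_eq_zero_of_upper_ne`, `GhostStencilReflectionQ.gammaCoeff_eq_zero_of_lower_ne`, `card_needle_le`, and `GhostStencil.l1_sub_le_of_blk_eq` for the
socket.  No `def`, no `def … : Prop`, nothing cited, 0 sorry.  Asserts no bound on any word ∕ table ∕ group; nothing of Bałaban's.  Root-level binders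
hW ∕ hR-sockets ∕ hSX-socket ∕ D1Tel ∕ D1Rep — 0 discharged; (K) NOT closed; NOT D1, NOT `BetaPertH`, NOT continuum, NOT Clay.

ABSOLUTE RULE (cell charter, verbatim): «No internally-minted statement may enter as a cited fact. Every hypothesis is either kernel-proved in this
package or a verbatim quotation of a PUBLISHED theorem with page reference. The manuscript(s) under audit are NOT citable for their own disputed
steps — they are the thing under adjudication; programme-internal (2001/route/tribunal) claims are never citable.»

WHY (an3-g56 (N-1) memo `HOME/b2b-balaban-beta-an3/gen56/NEEDLE-PROFILES.v1.md` 7fa163ef7e91e99e §0 (V2) «GHOST needle of record — by name ONLY crude: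
`GhostStencilRooted.abs_qJetAt_le` (`4/n³`), `biLoc_qAntiAt` (`8/n³·e^{8δ}`); the sharp `n⁻⁴`, the needle support and the block-ℓ¹ are ≤ 10-line corollaries of
the ROOT-GENERIC letters — SIGNATURES WRITTEN OUT as M1–M3 (§3)»; owner d1-p2-g9 «NEEDLE-GLUE» p255957: the ghost tables T4–T7 of the needle row consume
them).  The signatures below are an3's M1–M3; the in-block root hypothesis `hρ` of the proposed signatures is NOT needed (the contour letters are
root-generic) and is dropped — every statement holds for every `ρ : Site 4`.

CONTENT (all [folklore]; `B = B6QGQLower276.B (n − 1)` = the block of side `n`).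
* §1 M1 **`abs_qJetAt_le_inv_pow_four`** (`|qJetAt ρ n κ′ u y x| ≤ (n⁴)⁻¹`); M2 **`qJetAt_eq_zero_of_upper_ne`** (endpoint-side needle: `u_j ≠ x_j` for some `j > κ′`
  ⟹ `0`), **`qJetAt_eq_zero_of_lower_ne`** (root-side: `u_j ≠ (n•y + ρ)_j` for some `j < κ′` ⟹ `0`); `qJetAt_le_indicator`; M3 **`sum_B_abs_qJetAt_le`**
  (`Σ_{x ∈ B y} |qJetAt ρ n κ′ u y x| ≤ n^{κ′+1}·(n⁴)⁻¹`).
* §2 the kernel `qAntiAt ρ n κ′ u`: **`abs_qAntiAt_le`** (`≤ 2·(n⁴)⁻¹`), **`biLoc_qAntiAt_sharp`** (`BiLoc (qAntiAt ρ n κ′ u) u u (2·(n⁴)⁻¹·e^{8δ}) (δ/n)`, any `δ ≥ 0`),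
  `sum_B_abs_qJetAt_blk_le` and the COUNT × SUP block double sum **`sum_B_sum_B_abs_qAntiAt_le`** (`Σ_{x,z ∈ B y} |qAntiAt … x z| ≤ 2·n⁴·(n^{κ′+1}·(n⁴)⁻¹)`).
Unit `b2b-balaban-beta-d1-formalise-leaf-04` (gen 8), D1 formalisation swarm; `LEAVES-BFx.md` row (N) ∕ (N-1) letters M1–M3.
-/

noncomputable section

namespace Summit.QuantumFields.BalabanUV.Beta.D1BFx.GhostNeedleRootedLetters

open Finset
open scoped BigOperators
open Literature.MathematicalPhysics.QuantumFieldTheory.Balaban1983to89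
open Literature.MathematicalPhysics.QuantumFieldTheory.Balaban1983to89.Beta
open B12Sec2to5 (l1 l1_nonneg)
open B6QGQLower276 (blk B chart sum_B mem_B sum_B_const)
open ExpKernelCalculus (Site MKer BiLoc)
open GhostLeg (side_pred)
open GhostStencil (gammaCoeff l1_sub_le_of_blk_eq)
open Summit.QuantumFields.BalabanUV.Beta.D1BFx.GhostStencilReflectionQ (gammaCoeff_eq_zero_of_lower_ne)
open Summit.QuantumFields.BalabanUV.Beta.D1BFx.AveragingJetNeedle (abs_gammaCoeff_le_one gammaCoeff_eq_zero_of_upper_ne card_needle_le)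
open Summit.QuantumFields.BalabanUV.Beta.D1BFx.GhostStencilRooted (qJetAt qAntiAt qAntiAt_apply qJetAt_eq_zero)

variable (ρ : Site 4) (n : ℕ) [NeZero n] (κ' : Fin 4) (u : Site 4)

/-! ## §1 M1–M3 for the root-parametric averaging jet `qJetAt ρ n` -/

/-- [folklore] **M1 — SHARP SIZE OF THE ROOTED JET**: `|qJetAt ρ n κ′ u y x| ≤ (n⁴)⁻¹` for EVERY root `ρ` (the weight `n⁻⁴` times a contour
multiplicity of modulus `≤ 1`, `AveragingJetNeedle.abs_gammaCoeff_le_one` — root-generic; the tree's `GhostStencilRooted.abs_qJetAt_le` gives `4/n³`). -/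
theorem abs_qJetAt_le_inv_pow_four (y x : Site 4) : |qJetAt ρ n κ' u y x| ≤ ((n : ℝ) ^ 4)⁻¹ := by
  have hn : (0 : ℝ) < n := Nat.cast_pos.mpr (Nat.pos_of_ne_zero (NeZero.ne n))
  unfold qJetAt
  split_ifs with h
  · rw [abs_mul, abs_inv, abs_of_pos (pow_pos hn 4)]
    have h1 := abs_gammaCoeff_le_one κ' u ((n : ℤ) • y + ρ) x
    calc ((n : ℝ) ^ 4)⁻¹ * |gammaCoeff κ' u ((n : ℤ) • y + ρ) x| ≤ ((n : ℝ) ^ 4)⁻¹ * 1 :=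
          mul_le_mul_of_nonneg_left h1 (inv_nonneg.mpr (pow_pos hn 4).le)
      _ = ((n : ℝ) ^ 4)⁻¹ := mul_one _
  · rw [abs_zero]; positivity

omit [NeZero n] in
/-- [folklore] **M2 — ENDPOINT-SIDE NEEDLE SUPPORT**: `qJetAt ρ n κ′ u y x = 0` unless `x_j = u_j` for every coordinate `j > κ′` (every root `ρ`). -/
theorem qJetAt_eq_zero_of_upper_ne {x : Site 4} (j : Fin 4) (hj : (κ' : ℕ) < j) (hne : u j ≠ x j) (y : Site 4) :
    qJetAt ρ n κ' u y x = 0 := by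
  unfold qJetAt
  split_ifs with h
  · rw [gammaCoeff_eq_zero_of_upper_ne κ' j hj hne, mul_zero]
  · rfl

omit [NeZero n] in
/-- [folklore] **M2′ — ROOT-SIDE NEEDLE SUPPORT**: `qJetAt ρ n κ′ u y x = 0` unless `u_j = (n•y + ρ)_j` for every coordinate `j < κ′`
(`GhostStencilReflectionQ.gammaCoeff_eq_zero_of_lower_ne` at the root `n•y + ρ`). -/
theorem qJetAt_eq_zero_of_lower_ne {y : Site 4} (j : Fin 4) (hj : (j : ℕ) < κ') (hne : u j ≠ ((n : ℤ) • y + ρ) j) (x : Site 4) :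
    qJetAt ρ n κ' u y x = 0 := by
  unfold qJetAt
  split_ifs with h
  · rw [gammaCoeff_eq_zero_of_lower_ne κ' j hj hne, mul_zero]
  · rfl

/-- [folklore] The rooted jet is dominated by `n⁻⁴` times the indicator of the needle `{x : x_j = u_j ∀ j > κ′}` (M1 + M2). -/
theorem qJetAt_le_indicator (y x : Site 4) :
    |qJetAt ρ n κ' u y x| ≤ ((n : ℝ) ^ 4)⁻¹ * (if ∀ j : Fin 4, (κ' : ℕ) < j → x j = u j then 1 else 0) := by
  split_ifs with h
  · rw [mul_one]; exact abs_qJetAt_le_inv_pow_four ρ n κ' u y x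
  · push Not at h
    obtain ⟨j, hj, hne⟩ := h
    rw [qJetAt_eq_zero_of_upper_ne ρ n κ' u j hj (Ne.symm hne) y, abs_zero, mul_zero]

/-- [folklore] **M3 — THE NEEDLE WEIGHT OF ONE BACKGROUND BOND ON ITS BLOCK, ROOTED**: `Σ_{x ∈ B(y)} |qJetAt ρ n κ′ u y x| ≤ n^{κ′+1}·(n⁴)⁻¹`
(= `n^{κ′−3}`; the proof of `AveragingJetNeedle.sum_B_abs_qJet_le` verbatim — the needle count `card_needle_le` is root-free). -/
theorem sum_B_abs_qJetAt_le (y : Site 4) :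
    ∑ x ∈ B (n - 1) y, |qJetAt ρ n κ' u y x| ≤ (n : ℝ) ^ ((κ' : ℕ) + 1) * ((n : ℝ) ^ 4)⁻¹ := by
  have hn : (0 : ℝ) < n := Nat.cast_pos.mpr (Nat.pos_of_ne_zero (NeZero.ne n))
  have hw : (0 : ℝ) ≤ ((n : ℝ) ^ 4)⁻¹ := inv_nonneg.mpr (pow_pos hn 4).le
  -- pinned values of the local coordinates above `κ′`: `z_j = u_j − n·y_j`
  set c : Fin 4 → ℤ := fun j => u j - (n : ℤ) * y j with hc
  have hchart : ∀ (z : Fin 4 → Fin (n - 1 + 1)) (j : Fin 4), chart (n - 1) y z j = u j ↔ ((z j : ℕ) : ℤ) = c j := by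
    intro z j
    simp only [chart, side_pred, hc]
    constructor <;> intro h <;> linarith
  calc ∑ x ∈ B (n - 1) y, |qJetAt ρ n κ' u y x|
      ≤ ∑ x ∈ B (n - 1) y, ((n : ℝ) ^ 4)⁻¹ * (if ∀ j : Fin 4, (κ' : ℕ) < j → x j = u j then 1 else 0) :=
        Finset.sum_le_sum fun x _ => qJetAt_le_indicator ρ n κ' u y x
    _ = ((n : ℝ) ^ 4)⁻¹ * ∑ z : Fin 4 → Fin (n - 1 + 1),
          (if ∀ j : Fin 4, (κ' : ℕ) < j → ((z j : ℕ) : ℤ) = c j then (1 : ℝ) else 0) := by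
        rw [sum_B, ← Finset.mul_sum]
        congr 1
        refine Finset.sum_congr rfl fun z _ => ?_
        have : (∀ j : Fin 4, (κ' : ℕ) < j → chart (n - 1) y z j = u j) ↔ (∀ j : Fin 4, (κ' : ℕ) < j → ((z j : ℕ) : ℤ) = c j) :=
          forall_congr' fun j => imp_congr_right fun _ => hchart z j
        simp only [this]
    _ = ((n : ℝ) ^ 4)⁻¹ *
          ((Finset.univ.filter fun z : Fin 4 → Fin (n - 1 + 1) => ∀ j : Fin 4, (κ' : ℕ) < j → ((z j : ℕ) : ℤ) = c j).card : ℝ) := by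
        rw [Finset.sum_boole]
    _ ≤ ((n : ℝ) ^ 4)⁻¹ * (n : ℝ) ^ ((κ' : ℕ) + 1) := mul_le_mul_of_nonneg_left (card_needle_le n κ' c) hw
    _ = (n : ℝ) ^ ((κ' : ℕ) + 1) * ((n : ℝ) ^ 4)⁻¹ := mul_comm _ _

/-! ## §2 The kernel `qAntiAt ρ n κ′ u`: sharp entry bound, sharp socket, count × sup on a block -/

/-- [folklore] **SHARP ENTRY BOUND OF THE ROOTED STRIPPED JET**: `|qAntiAt ρ n κ′ u x z| ≤ 2·(n⁴)⁻¹` (two M1 terms). -/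
theorem abs_qAntiAt_le (x z : Site 4) (a b : Unit) : |qAntiAt ρ n κ' u x z a b| ≤ 2 * ((n : ℝ) ^ 4)⁻¹ := by
  rw [qAntiAt_apply]
  calc |qJetAt ρ n κ' u (blk (n - 1) x) z - qJetAt ρ n κ' u (blk (n - 1) z) x|
      ≤ |qJetAt ρ n κ' u (blk (n - 1) x) z| + |qJetAt ρ n κ' u (blk (n - 1) z) x| := abs_sub _ _
    _ ≤ ((n : ℝ) ^ 4)⁻¹ + ((n : ℝ) ^ 4)⁻¹ :=
        add_le_add (abs_qJetAt_le_inv_pow_four ρ n κ' u _ z) (abs_qJetAt_le_inv_pow_four ρ n κ' u _ x)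
    _ = 2 * ((n : ℝ) ^ 4)⁻¹ := by ring

/-- [folklore] **SHARP LOCALISATION SOCKET OF THE ROOTED STRIPPED JET** (the proof of `GhostStencilRooted.biLoc_qAntiAt` with M1 for `abs_qJetAt_le`; every
root `ρ`, every `δ ≥ 0`): `BiLoc (qAntiAt ρ n κ′ u) u u (2·(n⁴)⁻¹·e^{8δ}) (δ/n)` — the support is one block, so the rate `δ/n` is paid for by `e^{8δ}`. -/
theorem biLoc_qAntiAt_sharp {δ : ℝ} (hδ : 0 ≤ δ) :
    BiLoc (qAntiAt ρ n κ' u) u u (2 * ((n : ℝ) ^ 4)⁻¹ * Real.exp (8 * δ)) (δ / n) := by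
  have hn : (0 : ℝ) < n := Nat.cast_pos.mpr (Nat.pos_of_ne_zero (NeZero.ne n))
  intro x z a b
  rw [qAntiAt_apply]
  by_cases h : blk (n - 1) z = blk (n - 1) x ∧ blk (n - 1) u = blk (n - 1) x
  · have hx : l1 (x - u) ≤ 4 * n := l1_sub_le_of_blk_eq n h.2.symm
    have hz : l1 (z - u) ≤ 4 * n := l1_sub_le_of_blk_eq n (h.1.trans h.2.symm)
    have h1 := abs_qJetAt_le_inv_pow_four ρ n κ' u (blk (n - 1) x) z
    have h2 := abs_qJetAt_le_inv_pow_four ρ n κ' u (blk (n - 1) z) x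
    have h3 : δ / n * (l1 (x - u) + l1 (z - u)) ≤ δ / n * (8 * n) := mul_le_mul_of_nonneg_left (by linarith) (div_nonneg hδ hn.le)
    have h4 : δ / n * (8 * n) = 8 * δ := by field_simp
    have hE : Real.exp (-(8 * δ)) ≤ Real.exp (-(δ / n) * (l1 (x - u) + l1 (z - u))) := Real.exp_le_exp.mpr (by linarith)
    calc |qJetAt ρ n κ' u (blk (n - 1) x) z - qJetAt ρ n κ' u (blk (n - 1) z) x|
          ≤ |qJetAt ρ n κ' u (blk (n - 1) x) z| + |qJetAt ρ n κ' u (blk (n - 1) z) x| := abs_sub _ _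
      _ ≤ ((n : ℝ) ^ 4)⁻¹ + ((n : ℝ) ^ 4)⁻¹ := add_le_add h1 h2
      _ = 2 * ((n : ℝ) ^ 4)⁻¹ * Real.exp (8 * δ) * Real.exp (-(8 * δ)) := by
          rw [mul_assoc, ← Real.exp_add, add_neg_cancel, Real.exp_zero, mul_one]; ring
      _ ≤ 2 * ((n : ℝ) ^ 4)⁻¹ * Real.exp (8 * δ) * Real.exp (-(δ / n) * (l1 (x - u) + l1 (z - u))) :=
          mul_le_mul_of_nonneg_left hE (by positivity)
  · have h' : ¬(blk (n - 1) x = blk (n - 1) z ∧ blk (n - 1) u = blk (n - 1) z) :=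
      fun hh => h ⟨hh.1.symm, hh.2.trans hh.1.symm⟩
    rw [qJetAt_eq_zero ρ n κ' u h, qJetAt_eq_zero ρ n κ' u h', sub_zero, abs_zero]; positivity

/-- [folklore] M3 read at a fine site of the block: `Σ_{z ∈ B(blk x)} |qJetAt ρ n κ′ u (blk x) z| ≤ n^{κ′+1}·(n⁴)⁻¹`. -/
theorem sum_B_abs_qJetAt_blk_le (x : Site 4) :
    ∑ z ∈ B (n - 1) (blk (n - 1) x), |qJetAt ρ n κ' u (blk (n - 1) x) z| ≤ (n : ℝ) ^ ((κ' : ℕ) + 1) * ((n : ℝ) ^ 4)⁻¹ :=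
  sum_B_abs_qJetAt_le ρ n κ' u (blk (n - 1) x)

/-- [folklore] The block of side `n` has `n⁴` sites: `Σ_{x ∈ B(y)} c = n⁴·c` (`B6QGQLower276.sum_B_const` at side `n − 1 + 1 = n`). -/
theorem sum_B_const' (y : Site 4) (c : ℝ) : ∑ _x ∈ B (n - 1) y, c = (n : ℝ) ^ 4 * c := by
  have hn1 : (((n - 1 : ℕ) : ℝ) + 1) = (n : ℝ) := by
    have h : 1 ≤ n := Nat.pos_of_ne_zero (NeZero.ne n)
    rw [Nat.cast_sub h, Nat.cast_one, sub_add_cancel]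
  rw [sum_B_const, hn1]

/-- [folklore] **COUNT × SUP ON A BLOCK** (the bookkeeping atom of the `qA ⊗ qA`-type words): `Σ_{x ∈ B(y)} Σ_{z ∈ B(y)} |qAntiAt ρ n κ′ u x z| ≤ 2·n⁴·(n^{κ′+1}·(n⁴)⁻¹)`
— each of the two jets is summed over its fine argument by M3 (`n^{κ′+1}·n⁻⁴`), the other site over the block (`n⁴`). -/
theorem sum_B_sum_B_abs_qAntiAt_le (y : Site 4) (a b : Unit) :
    ∑ x ∈ B (n - 1) y, ∑ z ∈ B (n - 1) y, |qAntiAt ρ n κ' u x z a b| ≤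
      2 * ((n : ℝ) ^ 4 * ((n : ℝ) ^ ((κ' : ℕ) + 1) * ((n : ℝ) ^ 4)⁻¹)) := by
  have hsplit : ∀ x ∈ B (n - 1) y, ∀ z ∈ B (n - 1) y,
      |qAntiAt ρ n κ' u x z a b| ≤ |qJetAt ρ n κ' u y z| + |qJetAt ρ n κ' u y x| := by
    intro x hx z hz
    rw [qAntiAt_apply, mem_B.1 hx, mem_B.1 hz]
    exact abs_sub _ _
  calc ∑ x ∈ B (n - 1) y, ∑ z ∈ B (n - 1) y, |qAntiAt ρ n κ' u x z a b|
      ≤ ∑ x ∈ B (n - 1) y, ∑ z ∈ B (n - 1) y, (|qJetAt ρ n κ' u y z| + |qJetAt ρ n κ' u y x|) :=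
        Finset.sum_le_sum fun x hx => Finset.sum_le_sum fun z hz => hsplit x hx z hz
    _ = (∑ _x ∈ B (n - 1) y, ∑ z ∈ B (n - 1) y, |qJetAt ρ n κ' u y z|) +
          ∑ x ∈ B (n - 1) y, ∑ _z ∈ B (n - 1) y, |qJetAt ρ n κ' u y x| := by
        rw [← Finset.sum_add_distrib]
        refine Finset.sum_congr rfl fun x _ => Finset.sum_add_distrib
    _ ≤ (n : ℝ) ^ 4 * ((n : ℝ) ^ ((κ' : ℕ) + 1) * ((n : ℝ) ^ 4)⁻¹) + (n : ℝ) ^ 4 * ((n : ℝ) ^ ((κ' : ℕ) + 1) * ((n : ℝ) ^ 4)⁻¹) := by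
        refine add_le_add ?_ ?_
        · rw [sum_B_const' n y]
          exact mul_le_mul_of_nonneg_left (sum_B_abs_qJetAt_le ρ n κ' u y) (by positivity)
        · have e : ∑ x ∈ B (n - 1) y, ∑ _z ∈ B (n - 1) y, |qJetAt ρ n κ' u y x| =
              (n : ℝ) ^ 4 * ∑ x ∈ B (n - 1) y, |qJetAt ρ n κ' u y x| := by
            rw [Finset.mul_sum]
            refine Finset.sum_congr rfl fun x _ => ?_
            rw [sum_B_const' n y]
          rw [e]
          exact mul_le_mul_of_nonneg_left (sum_B_abs_qJetAt_le ρ n κ' u y) (by positivity)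
    _ = 2 * ((n : ℝ) ^ 4 * ((n : ℝ) ^ ((κ' : ℕ) + 1) * ((n : ℝ) ^ 4)⁻¹)) := by ring

end Summit.QuantumFields.BalabanUV.Beta.D1BFx.GhostNeedleRootedLetters

end
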